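import Literature.Computability.AlgebraicComplexity.SkewPairingMatrices
import HarnessLib

/-!
# Fixed-point-free involutions through two prescribed pairs; the exchange involution

Theorem-only add-on (cell `val-lit`, seat p8 g4) to `SkewPairingMatrices.lean` (val-lit t10 g4: the
signed perfect-matching matrices `J(π,s)` and `exists_involution_apply_eq`, one prescribed pair), for the
elementary route to the stabiliser bound of Landsberg–Manivel–Ressayre 2013, Prop. 3.5.1 (p. 481; cell memo
`HOME/lmr/X3b-ELEMENTARY-ROUTE-t10g4.md` §1 "involutions with prescribed pairs", used by the test families
T2/T4 of §4 and the exchange relations of §5):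

* `exists_involution_apply_eq₂` — a fixed-point-free involution `π` with `π a = b` can be conjugated (by
  `swap d (π c)`) into one with `π a = b` AND `π c = d`, for `{c, d}` disjoint from `{a, b}`; with
  `exists_involution_apply_eq` this gives involutions of `Fin (h + h)` through any two disjoint pairs
  (`exists_involution_apply_eq_apply_eq`);
* `exchange_involution` — if `π` pairs `a ↔ b` and `c ↔ d`, then `swap b c ∘ π ∘ swap b c` pairs `a ↔ c`,
  `b ↔ d` and agrees with `π` off `{a, b, c, d}`.

No definitions, no named facts. Honest framing: combinatorial plumbing; **VP ≠ VNP is NOT proved and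
nothing here is progress on it.**

## References

* [LandsbergManivelRessayre2013] Comment. Math. Helv. 88 (2013), §3.5, Prop. 3.5.1 (p. 481).
-/

namespace Literature.Computability.AlgebraicComplexity

namespace SkewAdj

/-- **Two prescribed pairs**: a fixed-point-free involution `π` with `π a = b` can be modified (conjugation
by `swap d (π c)`) to also satisfy `π c = d`, for `{c, d}` disjoint from `{a, b}`, `c ≠ d`.
[cite: LandsbergManivelRessayre2013, §3.5 (p. 481)] -/
theorem exists_involution_apply_eq₂ {α : Type*} [DecidableEq α] {π : Equiv.Perm α}
    (hπ : ∀ x, π (π x) = x) (hπ' : ∀ x, π x ≠ x) {a b c d : α} (hab : π a = b) (hcd : c ≠ d)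
    (hca : c ≠ a) (hcb : c ≠ b) (hda : d ≠ a) (hdb : d ≠ b) :
    ∃ π' : Equiv.Perm α, (∀ x, π' (π' x) = x) ∧ (∀ x, π' x ≠ x) ∧ π' a = b ∧ π' c = d := by
  let σ : Equiv.Perm α := Equiv.swap d (π c)
  have hσinv : σ⁻¹ = σ := Equiv.swap_inv d (π c)
  refine ⟨σ * π * σ⁻¹, (conj_involutive_fixedPointFree hπ hπ' σ).1,
    (conj_involutive_fixedPointFree hπ hπ' σ).2, ?_, ?_⟩
  · have hπc_a : π c ≠ a := fun h => hcb (by rw [← hab, ← h, hπ])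
    have hπc_b : π c ≠ b := fun h => hca (by rw [← hπ c, h, ← hab, hπ])
    rw [hσinv, Equiv.Perm.mul_apply, Equiv.Perm.mul_apply]
    simp only [σ]
    rw [Equiv.swap_apply_of_ne_of_ne hda.symm hπc_a.symm, hab,
      Equiv.swap_apply_of_ne_of_ne hdb.symm hπc_b.symm]
  · rw [hσinv, Equiv.Perm.mul_apply, Equiv.Perm.mul_apply]
    simp only [σ]
    rw [Equiv.swap_apply_of_ne_of_ne hcd (hπ' c).symm, Equiv.swap_apply_right]

/-- **A fixed-point-free involution of `Fin (h + h)` through two prescribed disjoint pairs** `{a, b}`,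
`{c, d}`. [cite: LandsbergManivelRessayre2013, §3.5 (p. 481)] -/
theorem exists_involution_apply_eq_apply_eq {h : ℕ} {a b c d : Fin (h + h)} (hab : a ≠ b) (hcd : c ≠ d)
    (hca : c ≠ a) (hcb : c ≠ b) (hda : d ≠ a) (hdb : d ≠ b) :
    ∃ π : Equiv.Perm (Fin (h + h)), (∀ x, π (π x) = x) ∧ (∀ x, π x ≠ x) ∧ π a = b ∧ π c = d := by
  obtain ⟨π, hπ, hπ', hπab⟩ := exists_involution_apply_eq hab
  exact exists_involution_apply_eq₂ hπ hπ' hπab hcd hca hcb hda hdb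

/-- **The exchange involution**: if `π` pairs `a ↔ b` and `c ↔ d`, then `swap b c ∘ π ∘ swap b c` is a
fixed-point-free involution pairing `a ↔ c` and `b ↔ d` and agreeing with `π` off `{a, b, c, d}` (source of
the exchange relations `a′_{ab} + a′_{cd} = a′_{ac} + a′_{bd}`, `n ≥ 5`).
[cite: LandsbergManivelRessayre2013, §3.5 (p. 481)] -/
theorem exchange_involution {α : Type*} [DecidableEq α] {π : Equiv.Perm α}
    (hπ : ∀ x, π (π x) = x) (hπ' : ∀ x, π x ≠ x) {a b c d : α} (hab : π a = b) (hcd : π c = d)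
    (hac : a ≠ c) (hbd : b ≠ d) :
    (∀ x, (Equiv.swap b c * π * Equiv.swap b c) ((Equiv.swap b c * π * Equiv.swap b c) x) = x) ∧
    (∀ x, (Equiv.swap b c * π * Equiv.swap b c) x ≠ x) ∧
    (Equiv.swap b c * π * Equiv.swap b c) a = c ∧
    (Equiv.swap b c * π * Equiv.swap b c) b = d ∧
    ∀ x, x ≠ a → x ≠ b → x ≠ c → x ≠ d → (Equiv.swap b c * π * Equiv.swap b c) x = π x := by
  have hinv : (Equiv.swap b c)⁻¹ = Equiv.swap b c := Equiv.swap_inv b c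
  have hab' : a ≠ b := fun h => hπ' a (by rw [hab, h])
  have hconj := conj_involutive_fixedPointFree hπ hπ' (Equiv.swap b c)
  rw [hinv] at hconj
  refine ⟨hconj.1, hconj.2, ?_, ?_, ?_⟩
  · rw [Equiv.Perm.mul_apply, Equiv.Perm.mul_apply, Equiv.swap_apply_of_ne_of_ne hab' hac, hab,
      Equiv.swap_apply_left]
  · have hdc : d ≠ c := fun h => hπ' c (by rw [hcd, h])
    rw [Equiv.Perm.mul_apply, Equiv.Perm.mul_apply, Equiv.swap_apply_left, hcd,
      Equiv.swap_apply_of_ne_of_ne hbd.symm hdc]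
  · intro x hxa hxb hxc hxd
    have hπx_b : π x ≠ b := fun h => hxa (by rw [← hπ x, h, ← hab, hπ])
    have hπx_c : π x ≠ c := fun h => hxd (by rw [← hπ x, h, hcd])
    rw [Equiv.Perm.mul_apply, Equiv.Perm.mul_apply, Equiv.swap_apply_of_ne_of_ne hxb hxc,
      Equiv.swap_apply_of_ne_of_ne hπx_b hπx_c]

end SkewAdj

end Literature.Computability.AlgebraicComplexity
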